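import Summits.HodgeConjecture.CorCM.GaloisDegenerateRealCompositum
import HarnessLib

/-!
# GOOD descends: if every primitive CM type of a Galois CM field `K` is nondegenerate, then so is every primitive CM type of each
# Galois CM subfield `K₀` with `[K : K₀] ≥ 3` (or `= 2` with a complement through complex conjugation)

COR-CM (cell `pub-hodgecm2`), binder seat b04 (gen 31), count-neutral own lane «Galois-CM-type classification»; the POSITIVE
(contrapositive) form of gen 31's monotonicity theorems `CorCM/GaloisDegenerateExtension`, `CorCM/GaloisDegenerateQuadraticSplit`,
`CorCM/GaloisDegenerateRealCompositum`, in the shape the lineage's GOOD theorems use (`∀ Φ φ₀, IsPrimitive Φ φ₀ → IsNondegenerate Φ`).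
KERNEL ONLY: theorems; no definition, no named fact, no `sorry`.  `HC_CM` is neither used nor claimed.

«GOOD(K)» := every primitive CM type of `K` is nondegenerate; by the tree (Hazama–Kubota–Pohlmann, gens 11–21) this is equivalent to:
the Hodge ring of every power of every SIMPLE abelian variety with CM by `K` is generated by divisor classes (`B = D`), which implies
the Hodge conjecture for all of them.  «BAD(K)» := some primitive CM type is degenerate ⟺ some power of some simple CM abelian variety
with CM by `K` carries a Hodge class outside the divisor ring (an EXCEPTIONAL class — its algebraicity is the open question; BAD does
not refute the Hodge conjecture).  THEOREMS:
* **`isNondegenerate_of_isPrimitive_of_subfield_good`** — `K ⊇ K₀` Galois CM, `[K:K₀] ≥ 3`, GOOD(K) ⟹ every primitive CM type of `K₀`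
  is nondegenerate; `…_intermediateField_good`, `…_fixedField_good` (`N ◁ Gal(K/ℚ)`, `c ∉ N`, `|N| ≥ 3`).
* **`isNondegenerate_of_isPrimitive_of_complement_two_good`** — `[K:K₀] = 2` with a complement of `Gal(K/K₀)` through complex
  conjugation.
* **`isNondegenerate_of_isPrimitive_of_compositum_good`** — `K = K₀·L`, `L` totally real, `[K₀:ℚ][L:ℚ] = [K:ℚ]`, `[L:ℚ] ≥ 2`.
So a GOOD verdict for `K` (e.g. the cyclic, dicyclic, metacyclic, `Q₈ × C_p` (ord_p 2 odd), `C_p ⋊ C₈` (`p ≡ 5 mod 8`) families) is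
inherited by all these quotient fields, and a BAD verdict for `K₀` by all these extensions.

## References

* [Kubota1965] T. Kubota, *On the field extension by complex multiplication*, Trans. AMS 118 (1965), §2, §4 Lemma 2.
* [Shimura1998] G. Shimura, *Abelian Varieties with Complex Multiplication and Modular Functions*, §6.2 Thm. 3, §8.2 Prop. 26.
* [Gordon1999HodgeAVSurvey] B. B. Gordon, *A survey of the Hodge conjecture for abelian varieties*, Thm. 6.4, §9.3.
-/

noncomputable section

open CategoryTheory CategoryTheory.Limits NumberField
open scoped BigOperators

namespace Summit.HodgeConjecture.CorCM.GaloisModels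

open Literature.NumberTheory.ComplexMultiplication
open Literature.AlgebraicGeometry.Motives (AbelianVariety CMType)
open Literature.AlgebraicGeometry.HodgeTheory
open Literature.AlgebraicGeometry.ComplexMultiplication (IsCMTypeRealisation)
open Literature.AlgebraicGeometry.Pohlmann1968

section Field

variable {K : Type} [Field K] [NumberField K] [IsCMField K] [IsGalois ℚ K]

/-- **GOOD DESCENDS ALONG EXTENSIONS OF DEGREE `≥ 3`.**  `K ⊇ K₀ ⊇ ℚ` Galois CM fields, `[K : K₀] ≥ 3`; if every primitive CM type
of `K` is nondegenerate, then every primitive CM type of `K₀` is nondegenerate. [cite: Kubota1965, §2 and §4 Lemma 2]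
[cite: Shimura1998, §8.2 Prop. 26] [cite: Gordon1999HodgeAVSurvey, §9.3] -/
theorem isNondegenerate_of_isPrimitive_of_subfield_good (K₀ : Type) [Field K₀] [NumberField K₀] [IsCMField K₀]
    [IsGalois ℚ K₀] [Algebra K₀ K] [IsScalarTower ℚ K₀ K] (hdeg : 3 ≤ Module.finrank K₀ K)
    (hK : ∀ (Φ : CMType K) (φ : K →+* ℂ), IsPrimitive (ℂ ≃+* ℂ) Φ.1 φ → IsNondegenerate Φ)
    {Φ₀ : CMType K₀} (φ₀ : K₀ →+* ℂ) (hprim : IsPrimitive (ℂ ≃+* ℂ) Φ₀.1 φ₀) : IsNondegenerate Φ₀ := by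
  by_contra h
  obtain ⟨Φ, φ, X, ι, ϑ, H1, H2, -⟩ := exists_simple_degenerate_of_subfield K₀ hdeg Φ₀ φ₀ hprim h
  exact H2 (hK Φ φ H1)

/-- **… for an intermediate field** `K₀ ≤ K`, Galois CM, `[K:K₀] ≥ 3`. [cite: Kubota1965, §2 and §4 Lemma 2]
[cite: Shimura1998, §8.2 Prop. 26] [cite: Gordon1999HodgeAVSurvey, §9.3] -/
theorem isNondegenerate_of_isPrimitive_of_intermediateField_good (K₀ : IntermediateField ℚ K) [IsCMField K₀] [IsGalois ℚ K₀]
    (hdeg : 3 ≤ Module.finrank K₀ K)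
    (hK : ∀ (Φ : CMType K) (φ : K →+* ℂ), IsPrimitive (ℂ ≃+* ℂ) Φ.1 φ → IsNondegenerate Φ)
    {Φ₀ : CMType K₀} (φ₀ : K₀ →+* ℂ) (hprim : IsPrimitive (ℂ ≃+* ℂ) Φ₀.1 φ₀) : IsNondegenerate Φ₀ :=
  isNondegenerate_of_isPrimitive_of_subfield_good K₀ hdeg hK φ₀ hprim

/-- **… for a fixed field `K^N`**, `N ◁ Gal(K/ℚ)` with complex conjugation `∉ N` and `|N| ≥ 3`. [cite: Kubota1965, §2 and §4 Lemma 2]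
[cite: Shimura1998, §8.2 Prop. 26] [cite: Gordon1999HodgeAVSurvey, §9.3] -/
theorem isNondegenerate_of_isPrimitive_of_fixedField_good (N : Subgroup (K ≃ₐ[ℚ] K)) [N.Normal]
    (hc : (IsCMField.complexConj K).restrictScalars ℚ ∉ N) (hN : 3 ≤ Nat.card N)
    (hK : ∀ (Φ : CMType K) (φ : K →+* ℂ), IsPrimitive (ℂ ≃+* ℂ) Φ.1 φ → IsNondegenerate Φ)
    {Φ₀ : CMType (IntermediateField.fixedField N)} (φ₀ : IntermediateField.fixedField N →+* ℂ)
    (hprim : IsPrimitive (ℂ ≃+* ℂ) Φ₀.1 φ₀) : IsNondegenerate Φ₀ := by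
  by_contra h
  obtain ⟨Φ, φ, X, ι, ϑ, H1, H2, -⟩ := exists_simple_degenerate_of_fixedField N hc hN Φ₀ φ₀ hprim h
  exact H2 (hK Φ φ H1)

/-- **GOOD DESCENDS ALONG QUADRATIC EXTENSIONS SPLIT THROUGH COMPLEX CONJUGATION.**  `[K : K₀] = 2`, `Γ ≤ Gal(K/ℚ)` containing
complex conjugation with `Γ ∩ Gal(K/K₀) = 1`, `|Γ| = [K₀:ℚ]`; GOOD(K) ⟹ every primitive CM type of `K₀` is nondegenerate.
[cite: Kubota1965, §2 and §4 Lemma 2] [cite: Shimura1998, §8.2 Prop. 26] [cite: Gordon1999HodgeAVSurvey, §9.3, §9.4.3] -/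
theorem isNondegenerate_of_isPrimitive_of_complement_two_good (K₀ : Type) [Field K₀] [NumberField K₀] [IsCMField K₀]
    [IsGalois ℚ K₀] [Algebra K₀ K] [IsScalarTower ℚ K₀ K] (Γ : Subgroup (K ≃ₐ[ℚ] K))
    (hcΓ : (IsCMField.complexConj K).restrictScalars ℚ ∈ Γ)
    (hdisj : ∀ g ∈ Γ, AlgEquiv.restrictNormalHom K₀ g = 1 → g = 1) (hcard : Nat.card Γ = Module.finrank ℚ K₀)
    (hdeg : Module.finrank K₀ K = 2)
    (hK : ∀ (Φ : CMType K) (φ : K →+* ℂ), IsPrimitive (ℂ ≃+* ℂ) Φ.1 φ → IsNondegenerate Φ)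
    {Φ₀ : CMType K₀} (φ₀ : K₀ →+* ℂ) (hprim : IsPrimitive (ℂ ≃+* ℂ) Φ₀.1 φ₀) : IsNondegenerate Φ₀ := by
  by_contra h
  obtain ⟨Φ, φ, X, ι, ϑ, H1, H2, -⟩ :=
    exists_simple_degenerate_of_subfield_complement_two_all K₀ Γ hcΓ hdisj hcard hdeg Φ₀ φ₀ hprim h
  exact H2 (hK Φ φ H1)

/-- **GOOD DESCENDS FROM A COMPOSITUM WITH A TOTALLY REAL FIELD.**  `K` Galois CM, `K₀, L ≤ K` with `K₀` Galois CM, `L` fixed by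
complex conjugation, `K₀ ⊔ L = K`, `[K₀:ℚ]·[L:ℚ] = [K:ℚ]`, `[L:ℚ] ≥ 2`; GOOD(K) ⟹ every primitive CM type of `K₀` is nondegenerate.
[cite: Kubota1965, §2 and §4 Lemma 2] [cite: Shimura1998, §8.2 Prop. 26] [cite: Gordon1999HodgeAVSurvey, §9.3] -/
theorem isNondegenerate_of_isPrimitive_of_compositum_good (K₀ L : IntermediateField ℚ K) [IsCMField K₀] [IsGalois ℚ K₀]
    (hL : ∀ x ∈ L, IsCMField.complexConj K x = x) (hsup : K₀ ⊔ L = ⊤)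
    (hcard : Module.finrank ℚ K₀ * Module.finrank ℚ L = Module.finrank ℚ K) (hdegL : 2 ≤ Module.finrank ℚ L)
    (hK : ∀ (Φ : CMType K) (φ : K →+* ℂ), IsPrimitive (ℂ ≃+* ℂ) Φ.1 φ → IsNondegenerate Φ)
    {Φ₀ : CMType K₀} (φ₀ : K₀ →+* ℂ) (hprim : IsPrimitive (ℂ ≃+* ℂ) Φ₀.1 φ₀) : IsNondegenerate Φ₀ := by
  by_contra h
  obtain ⟨Φ, φ, X, ι, ϑ, H1, H2, -⟩ := exists_simple_degenerate_of_compositum K₀ L hL hsup hcard hdegL Φ₀ φ₀ hprim h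
  exact H2 (hK Φ φ H1)

end Field

end Summit.HodgeConjecture.CorCM.GaloisModels

end
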